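import Literature.Probability.FitznerVanDerHofstad2017.SrwCellImSupsD10
import Literature.Probability.FitznerVanDerHofstad2017.F3BoundsCellNumQ
import HarnessLib

/-!
# The all-`ℚ` closing layer of the `d := 10` small-`x` `f₃` slots (what-if lane)

[NoBLE] = Fitzner–van der Hofstad, *Mean-field behavior for nearest-neighbor percolation in `d > 10`*,
EJP **22** (2017) no. 43 (its §3.3.5, (3.58)–(3.64) and (3.87) p. 1076–1079: the cell bound of `f₃` from the
tables `IM`, `T`, `U`, `K`; §5.1 p. 1093 and §5.2 (5.9), (5.11), (5.15) p. 1092: the SRW sups on `𝒳`, on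
`Q = {‖x‖₁ ≥ 3}` and its three cones, and at the origin).  [FvdH17] = Fitzner–van der Hofstad, *Generalized
approach to the non-backtracking lace expansion*, PTRF **169** (2017), §2.5 (the numerical assumption is checked
entry by entry from rational data).

This module sits on top of the three landed `d := 10` cell modules and fixes NO data: every dimension-10 table
it uses is read BY NAME from `CellSupD10` (`T`/`U`/`K` sups, p239219), `CellImD10` (`IM` reads and the all-`ℚ`
entry constructors, p248959) and `F3Bounds.CellNumQ` (the `ℚ` mirror `boundHD75Q` of the bound map, p250016).
What it adds is the last layer that makes EVERY hypothesis of a cell theorem a decidable statement over `ℚ`: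

* §1 — `ℚ` mirrors `tXDQ α`, `tQDQ α`, `tNDQ α nd` of the DIRECT `T`-slot literals `CellSupD10.tXD / tQD / tND`
  (`min (rule literal) (K_{m,l+1} + (2/a)·U_{m+1,l})`, real-valued in `a`), their cast identities, and the closing
  rules `boundHD75_cellXD_le_of_ratLe` / `…QD…` / `…ND…`: the numeral hypothesis `hnum` of the nine direct-slot
  cell theorems `CellSupD10.f3cellD10D_*` is one `decide +kernel` at rational data, exactly as for the rule slot.
* §2 — per-ENTRY Boolean checks with AUTOMATIC branch choice: `cellChk α ᾱ m l t` = index ranges ∧ (print's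
  triple (3.64) on the named reads ∨ the corrected two-branch envelope `envQ … ≤ t`), and likewise `coneChk v`,
  `originChk`, and the `m = −1` pair checks `negOneFstChk` / `negOneSndChk` (cone versions `coneNegOne…`); each
  with a soundness theorem concluding the corresponding `CellDomAlt` / `OnDomAlt` / `OriginDomAlt` / pair
  inequality at `d = 10` (one-line consequences of the landed `CellImD10.…Q` constructors).
* §3 — per-SLOT closing theorems whose every hypothesis is decidable: `𝒳`-cells `(0,l)`, `(1,l)`, cone cells on
  `Cn.cone v`, the glued `Q`-shape `∀ x, 3 ≤ Σ|x_j| → …`, and the origin cell `(1,l)`, for both `T` variants.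
  Binders `(α ᾱ : ℚ) (aq : ArgsQ) (IMq : ℤ → ℕ → ℚ) (bq : ℚ)`; conclusion = the conclusion of the corresponding
  `CellSupD10.f3cellD10[D]_*` theorem at `(α : ℝ) (ᾱ : ℝ) aq.toArgs (bq : ℝ)`.  At rational literals every hypothesis is ONE
  `by decide +kernel` (pass `(IMq := …)` by name: it occurs only in the hypotheses).

Not in scope: the AT-node shapes `CellSupD10.f3cellD10_{zero,one}_at_le` (their `IM` hypotheses are node VALUES;
no literal reads beyond the `𝒳` sups exist for the shell nodes), any tuple, any table value.  What-if /
input-certification lane: the record (CERT REV 14) and its frame are untouched; no `…Of 10` / `…At 10` structure or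
statement is instantiated; every table value is a landed literal read by name.
-/

namespace Literature.Probability.FitznerVanDerHofstad2017

namespace SlotD10

open Literature.Barriers.CriticalPhenomena Literature.Probability.LatticeModels
open F3Bounds F3Bounds.CellNumQ KTUD10 KSupD10 TUSupD10 JSupD10 CellSupD10 CellImD10

/-! ### §1  `ℚ` mirrors of the direct `T`-slot literals and their closing rules -/

/-- `ℚ` mirror of the direct `T`-slot literal over `𝒳`: `min (tS2 m l) (kS2 m (l+1) + (2/α)·uS2 (m+1) l)`.
[cite: FitznerVanDerHofstad2016NoBLE, §5.2 (5.9), (5.11), (5.15) p. 1092; §3.3.5 (3.87) p. 1079] -/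
def tXDQ (α : ℚ) (m l : ℕ) : ℚ := min (tS2 m l) (kS2 m (l + 1) + 2 / α * uS2 (m + 1) l)

/-- `ℚ` mirror of the direct `T`-slot literal over `Q10` and its cones: `min (tS3 m l) (kS3 m (l+1) + (2/α)·uS3 (m+1) l)`.
[cite: FitznerVanDerHofstad2016NoBLE, §5.2 (5.9), (5.11), (5.15) p. 1092; §5.1 p. 1093] -/
def tQDQ (α : ℚ) (m l : ℕ) : ℚ := min (tS3 m l) (kS3 m (l + 1) + 2 / α * uS3 (m + 1) l)

/-- `ℚ` mirror of the direct `T`-slot literal AT the node `nd`: `min (tA m l nd) (kA m (l+1) nd + (2/α)·uA (m+1) l nd)`.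
[cite: FitznerVanDerHofstad2016NoBLE, §5.2 (5.9), (5.11), (5.15) p. 1092; §3.3.5 (3.87) p. 1079 (cell `{0}`)] -/
def tNDQ (α : ℚ) (nd : Nd) (m l : ℕ) : ℚ := min (tA m l nd) (kA m (l + 1) nd + 2 / α * uA (m + 1) l nd)

/-- Cast identity `((tXDQ α m l : ℚ) : ℝ) = tXD α m l`. [cite: FitznerVanDerHofstad2016NoBLE, §5.2 (5.9), (5.11), (5.15) p. 1092] -/
theorem cast_tXDQ (α : ℚ) (m l : ℕ) : ((tXDQ α m l : ℚ) : ℝ) = tXD (α : ℝ) m l := by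
  simp only [tXDQ, tXD, tX, kX, uX]
  push_cast
  rfl

/-- Cast identity `((tQDQ α m l : ℚ) : ℝ) = tQD α m l`. [cite: FitznerVanDerHofstad2016NoBLE, §5.2 (5.9), (5.11), (5.15) p. 1092; §5.1 p. 1093] -/
theorem cast_tQDQ (α : ℚ) (m l : ℕ) : ((tQDQ α m l : ℚ) : ℝ) = tQD (α : ℝ) m l := by
  simp only [tQDQ, tQD, tQ, kQ, uQ]
  push_cast
  rfl

/-- Cast identity `((tNDQ α nd m l : ℚ) : ℝ) = tND α nd m l`. [cite: FitznerVanDerHofstad2016NoBLE, §5.2 (5.9), (5.11), (5.15) p. 1092; §3.3.5 (3.87) p. 1079] -/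
theorem cast_tNDQ (α : ℚ) (nd : Nd) (m l : ℕ) : ((tNDQ α nd m l : ℚ) : ℝ) = tND (α : ℝ) nd m l := by
  simp only [tNDQ, tND, tN, kN, uN]
  push_cast
  rfl

/-- `tXD α` is the cast of `tXDQ α`, as a table. [cite: FitznerVanDerHofstad2016NoBLE, §5.2 (5.9), (5.11), (5.15) p. 1092] -/
theorem tXD_eq_cast (α : ℚ) : tXD (α : ℝ) = fun m l => ((tXDQ α m l : ℚ) : ℝ) :=
  funext fun m => funext fun l => (cast_tXDQ α m l).symm

/-- `tQD α` is the cast of `tQDQ α`, as a table. [cite: FitznerVanDerHofstad2016NoBLE, §5.2 (5.9), (5.11), (5.15) p. 1092; §5.1 p. 1093] -/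
theorem tQD_eq_cast (α : ℚ) : tQD (α : ℝ) = fun m l => ((tQDQ α m l : ℚ) : ℝ) :=
  funext fun m => funext fun l => (cast_tQDQ α m l).symm

/-- `tND α nd` is the cast of `tNDQ α nd`, as a table. [cite: FitznerVanDerHofstad2016NoBLE, §5.2 (5.9), (5.11), (5.15) p. 1092; §3.3.5 (3.87) p. 1079] -/
theorem tND_eq_cast (α : ℚ) (nd : Nd) : tND (α : ℝ) nd = fun m l => ((tNDQ α nd m l : ℚ) : ℝ) :=
  funext fun m => funext fun l => (cast_tNDQ α nd m l).symm

/-- **Closing rule, direct `T` slot over `𝒳`**: `boundHD75Q IMq (tXDQ α) uS2 kS2 n l aq ≤ bq` (one `decide +kernel`) gives the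
numeral hypothesis `hnum` of `CellSupD10.f3cellD10D_{zero,one}_calX_le` at `(α : ℝ)`, `aq.toArgs`, `(bq : ℝ)`.
[cite: FitznerVanDerHofstad2016NoBLE, §3.3.5 (3.58)–(3.63), (3.87) p. 1076–1079; §5.2 (5.9), (5.11), (5.15) p. 1092] [cite: FitznerVanDerHofstad2017, §2.5] -/
theorem boundHD75_cellXD_le_of_ratLe (IMq : ℤ → ℕ → ℚ) {α : ℚ} {n l : ℕ} {aq : ArgsQ} {bq : ℚ}
    (h : boundHD75Q IMq (tXDQ α) uS2 kS2 n l aq ≤ bq) :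
    boundHD75 (Tables.cell (fun m l => ((IMq m l : ℚ) : ℝ)) (tXD (α : ℝ)) uX kX : Tables (Fin 10 → ℤ)) n l 0 aq.toArgs
      ≤ ((bq : ℚ) : ℝ) := by
  rw [tXD_eq_cast]
  exact boundHD75_cell_le_of_ratLe IMq (tXDQ α) uS2 kS2 0 h

/-- **Closing rule, direct `T` slot over `Q10` / the cones**: the `hnum` of `CellSupD10.f3cellD10D_{zero,one}_{on,Q}_le`.
[cite: FitznerVanDerHofstad2016NoBLE, §3.3.5 (3.58)–(3.63), (3.87) p. 1076–1079; §5.1 p. 1093; §5.2 (5.9), (5.11), (5.15) p. 1092] [cite: FitznerVanDerHofstad2017, §2.5] -/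
theorem boundHD75_cellQD_le_of_ratLe (IMq : ℤ → ℕ → ℚ) {α : ℚ} {n l : ℕ} {aq : ArgsQ} {bq : ℚ}
    (h : boundHD75Q IMq (tQDQ α) uS3 kS3 n l aq ≤ bq) :
    boundHD75 (Tables.cell (fun m l => ((IMq m l : ℚ) : ℝ)) (tQD (α : ℝ)) uQ kQ : Tables (Fin 10 → ℤ)) n l 0 aq.toArgs
      ≤ ((bq : ℚ) : ℝ) := by
  rw [tQD_eq_cast]
  exact boundHD75_cell_le_of_ratLe IMq (tQDQ α) uS3 kS3 0 h

/-- **Closing rule, direct `T` slot AT the node `nd`** (origin `nd = .n0`): the `hnum` of `CellSupD10.f3cellD10D_one_zero_le` /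
`f3cellD10D_{zero,one}_at_le`. [cite: FitznerVanDerHofstad2016NoBLE, §3.3.5 (3.58)–(3.63), (3.87) p. 1076–1079 (cell `{0}`); §5.2 (5.9), (5.11), (5.15) p. 1092] [cite: FitznerVanDerHofstad2017, §2.5] -/
theorem boundHD75_cellND_le_of_ratLe (IMq : ℤ → ℕ → ℚ) {α : ℚ} (nd : Nd) {n l : ℕ} {aq : ArgsQ} {bq : ℚ}
    (h : boundHD75Q IMq (tNDQ α nd) (fun n l => uA n l nd) (fun n l => kA n l nd) n l aq ≤ bq) :
    boundHD75 (Tables.cell (fun m l => ((IMq m l : ℚ) : ℝ)) (tND (α : ℝ) nd) (uN nd) (kN nd) : Tables (Fin 10 → ℤ)) n l 0 aq.toArgs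
      ≤ ((bq : ℚ) : ℝ) := by
  rw [tND_eq_cast]
  exact boundHD75_cell_le_of_ratLe IMq (tNDQ α nd) (fun n l => uA n l nd) (fun n l => kA n l nd) 0 h

/-- **Closing rule, rule `T` slot AT the node `nd`** (origin `nd = .n0`), tables `tN uN kN nd` named: the `hnum` of
`CellSupD10.f3cellD10_one_zero_le` / `f3cellD10_{zero,one}_at_le`. [cite: FitznerVanDerHofstad2016NoBLE, §3.3.5 (3.58)–(3.63), (3.87) p. 1076–1079 (cell `{0}`); §5.2 (5.11) p. 1092] [cite: FitznerVanDerHofstad2017, §2.5] -/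
theorem boundHD75_cellN_le_of_ratLe (IMq : ℤ → ℕ → ℚ) (nd : Nd) {n l : ℕ} {aq : ArgsQ} {bq : ℚ}
    (h : boundHD75Q IMq (fun m l => tA m l nd) (fun n l => uA n l nd) (fun n l => kA n l nd) n l aq ≤ bq) :
    boundHD75 (Tables.cell (fun m l => ((IMq m l : ℚ) : ℝ)) (tN nd) (uN nd) (kN nd) : Tables (Fin 10 → ℤ)) n l 0 aq.toArgs
      ≤ ((bq : ℚ) : ℝ) :=
  boundHD75_cell_le_of_ratLe IMq (fun m l => tA m l nd) (fun n l => uA n l nd) (fun n l => kA n l nd) 0 h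

/-! ### §2  Per-entry Boolean checks with automatic branch choice, and their soundness -/

section Entry

variable {α amax t : ℚ} {m l : ℕ}

/-- Print's triple (3.64) for an `𝒳`-cell entry, on the named reads: `J ≤ t ∧ I ≤ 10·α·t ∧ (ᾱ−1)·S ≤ 2·10²·t`.
[cite: FitznerVanDerHofstad2016NoBLE, §3.3.5 (3.64) p. 1076] -/
def cellPrintChk (α amax : ℚ) (m l : ℕ) (t : ℚ) : Bool :=
  decide (jXQ m l ≤ t) && decide (iN2Q (m + 3) l ≤ 10 * α * t) && decide ((amax - 1) * sN2Q (m + 3) l ≤ 2 * 10 ^ 2 * t)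

/-- The corrected two-branch envelope for an `𝒳`-cell entry: `envQ J I S α ᾱ ≤ t`. [cite: FitznerVanDerHofstad2016NoBLE, §3.3.5 (3.61)–(3.62) p. 1076] -/
def cellEnvChk (α amax : ℚ) (m l : ℕ) (t : ℚ) : Bool :=
  decide (envQ (jXQ m l) (iN2Q (m + 3) l) (sN2Q (m + 3) l) α amax ≤ t)

/-- **`𝒳`-cell entry check**: index ranges `m ≤ 1`, `l ≤ 7`, then print's triple OR the envelope. [cite: FitznerVanDerHofstad2016NoBLE, §3.3.5 (3.61)–(3.64) p. 1076] -/
def cellChk (α amax : ℚ) (m l : ℕ) (t : ℚ) : Bool :=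
  decide (m ≤ 1) && decide (l ≤ 7) && (cellPrintChk α amax m l t || cellEnvChk α amax m l t)

/-- Soundness of `cellChk`: `CellDomAlt 10 α ᾱ m l t`. [cite: FitznerVanDerHofstad2016NoBLE, §3.3.5 (3.61)–(3.64) p. 1076] -/
theorem cellDomAlt_of_chk (hα : 0 < α) (hᾱ : 1 ≤ amax) (h : cellChk α amax m l t = true) :
    CellDomAlt 10 (α : ℝ) (amax : ℝ) m l (t : ℝ) := by
  simp only [cellChk, cellPrintChk, cellEnvChk, Bool.and_eq_true, Bool.or_eq_true, decide_eq_true_eq] at h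
  obtain ⟨⟨hm, hl⟩, ⟨⟨h1, h2⟩, h3⟩ | he⟩ := h
  · exact cellDomAlt_d10_of_printedQ hᾱ hm hl h1 h2 h3
  · exact cellDomAlt_d10_of_envQ hα hᾱ hm hl he

/-- **First `m = −1` node inequality check over `𝒳`**: `l ≤ 21 ∧ iN2Q 1 (l+1) + sN2Q 2 l / (2·10²·α) ≤ t`.
[cite: FitznerVanDerHofstad2016NoBLE, §3.3.5 (3.87) p. 1079, lowest-order points of `𝒳`; (3.30) p. 1070] -/
def negOneFstChk (α : ℚ) (l : ℕ) (t : ℚ) : Bool :=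
  decide (l ≤ 21) && decide (iN2Q 1 (l + 1) + sN2Q 2 l / (2 * 10 ^ 2 * α) ≤ t)

/-- Soundness of `negOneFstChk`. [cite: FitznerVanDerHofstad2016NoBLE, §3.3.5 (3.87) p. 1079; (3.30) p. 1070] -/
theorem negOne_fst_of_chk (hα : 0 < α) (h : negOneFstChk α l t = true) :
    srwINode2 10 1 (l + 1) + srwIShift2Node2 10 2 l / (2 * ((10 : ℕ) : ℝ) ^ 2 * (α : ℝ)) ≤ (t : ℝ) := by
  simp only [negOneFstChk, Bool.and_eq_true, decide_eq_true_eq] at h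
  exact imNegOne_fst_node_d10Q hα h.1 h.2

/-- **Second `m = −1` node inequality check over `𝒳`**: `l ≤ 22 ∧ iN2Q 2 l ≤ 10·α·t`. [cite: FitznerVanDerHofstad2016NoBLE, §3.3.5 (3.87) p. 1079; (3.30) p. 1070] -/
def negOneSndChk (α : ℚ) (l : ℕ) (t : ℚ) : Bool :=
  decide (l ≤ 22) && decide (iN2Q 2 l ≤ 10 * α * t)

/-- Soundness of `negOneSndChk`. [cite: FitznerVanDerHofstad2016NoBLE, §3.3.5 (3.87) p. 1079; (3.30) p. 1070] -/
theorem negOne_snd_of_chk (h : negOneSndChk α l t = true) :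
    srwINode2 10 2 l ≤ ((10 : ℕ) : ℝ) * (α : ℝ) * (t : ℝ) := by
  simp only [negOneSndChk, Bool.and_eq_true, decide_eq_true_eq] at h
  exact imNegOne_snd_node_d10Q h.1 h.2

/-- Print's triple (3.64) for a cone-cell entry on the cone `v`, on the named cone reads. [cite: FitznerVanDerHofstad2016NoBLE, §3.3.5 (3.64) p. 1076; §5.1 p. 1093] -/
def conePrintChk (v : Cn) (α amax : ℚ) (m l : ℕ) (t : ℚ) : Bool :=
  decide (jCQ v m l ≤ t) && decide (iCQ v (m + 3) l ≤ 10 * α * t) && decide ((amax - 1) * sCQ v (m + 3) l ≤ 2 * 10 ^ 2 * t)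

/-- The corrected two-branch envelope for a cone-cell entry. [cite: FitznerVanDerHofstad2016NoBLE, §3.3.5 (3.61)–(3.62) p. 1076; §5.1 p. 1093] -/
def coneEnvChk (v : Cn) (α amax : ℚ) (m l : ℕ) (t : ℚ) : Bool :=
  decide (envQ (jCQ v m l) (iCQ v (m + 3) l) (sCQ v (m + 3) l) α amax ≤ t)

/-- **Cone-cell entry check** on `Cn.cone v`: `m ≤ 1`, `l ≤ Cn.lJ v m`, then print's triple OR the envelope.
[cite: FitznerVanDerHofstad2016NoBLE, §3.3.5 (3.61)–(3.64) p. 1076; §5.1 p. 1093] -/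
def coneChk (v : Cn) (α amax : ℚ) (m l : ℕ) (t : ℚ) : Bool :=
  decide (m ≤ 1) && decide (l ≤ v.lJ m) && (conePrintChk v α amax m l t || coneEnvChk v α amax m l t)

/-- Soundness of `coneChk`: `OnDomAlt 10 α ᾱ (Cn.cone v) m l t`. [cite: FitznerVanDerHofstad2016NoBLE, §3.3.5 (3.61)–(3.64) p. 1076; §5.1 p. 1093] -/
theorem onDomAlt_of_chk (v : Cn) (hᾱ : 1 ≤ amax) (h : coneChk v α amax m l t = true) :
    OnDomAlt 10 (α : ℝ) (amax : ℝ) v.cone m l (t : ℝ) := by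
  simp only [coneChk, conePrintChk, coneEnvChk, Bool.and_eq_true, Bool.or_eq_true, decide_eq_true_eq] at h
  obtain ⟨⟨hm, hl⟩, ⟨⟨h1, h2⟩, h3⟩ | he⟩ := h
  · exact onDomAlt_cone_d10_of_printedQ v hᾱ hm hl h1 h2 h3
  · exact onDomAlt_cone_d10_of_envQ v hm hl he

/-- **First `m = −1` inequality check on the cone `v`**: `l ≤ 21 ∧ iCQ v 1 (l+1) + sCQ v 2 l / (2·10²·α) ≤ t`.
[cite: FitznerVanDerHofstad2016NoBLE, §3.3.5 (3.87) p. 1079; §5.1 p. 1093; (3.30) p. 1070] -/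
def coneNegOneFstChk (v : Cn) (α : ℚ) (l : ℕ) (t : ℚ) : Bool :=
  decide (l ≤ 21) && decide (iCQ v 1 (l + 1) + sCQ v 2 l / (2 * 10 ^ 2 * α) ≤ t)

/-- Soundness of `coneNegOneFstChk`. [cite: FitznerVanDerHofstad2016NoBLE, §3.3.5 (3.87) p. 1079; §5.1 p. 1093; (3.30) p. 1070] -/
theorem coneNegOne_fst_of_chk (v : Cn) (hα : 0 < α) (h : coneNegOneFstChk v α l t = true) :
    ∀ x ∈ v.cone, srwI 10 1 (l + 1) x + srwIShift2 10 2 l x / (2 * ((10 : ℕ) : ℝ) ^ 2 * (α : ℝ)) ≤ (t : ℝ) := by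
  simp only [coneNegOneFstChk, Bool.and_eq_true, decide_eq_true_eq] at h
  exact imNegOne_fst_cone_d10Q v hα h.1 h.2

/-- **Second `m = −1` inequality check on the cone `v`**: `l ≤ 22 ∧ iCQ v 2 l ≤ 10·α·t`. [cite: FitznerVanDerHofstad2016NoBLE, §3.3.5 (3.87) p. 1079; §5.1 p. 1093; (3.30) p. 1070] -/
def coneNegOneSndChk (v : Cn) (α : ℚ) (l : ℕ) (t : ℚ) : Bool :=
  decide (l ≤ 22) && decide (iCQ v 2 l ≤ 10 * α * t)

/-- Soundness of `coneNegOneSndChk`. [cite: FitznerVanDerHofstad2016NoBLE, §3.3.5 (3.87) p. 1079; §5.1 p. 1093; (3.30) p. 1070] -/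
theorem coneNegOne_snd_of_chk (v : Cn) (h : coneNegOneSndChk v α l t = true) :
    ∀ x ∈ v.cone, srwI 10 2 l x ≤ ((10 : ℕ) : ℝ) * (α : ℝ) * (t : ℝ) := by
  simp only [coneNegOneSndChk, Bool.and_eq_true, decide_eq_true_eq] at h
  exact imNegOne_snd_cone_d10Q v h.1 h.2

/-- Print's triple (3.64) for an origin-cell entry, on the named origin reads (symmetrised shift `S ≤ 2·10·I(2e₁)` of (3.30)).
[cite: FitznerVanDerHofstad2016NoBLE, §3.3.5 (3.64) p. 1076; (3.30) p. 1070; (3.87) p. 1079 (cell `{0}`)] -/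
def originPrintChk (α amax : ℚ) (m l : ℕ) (t : ℚ) : Bool :=
  decide (jOQ m l ≤ t) && decide (i0Q (m + 3) l ≤ 10 * α * t) && decide ((amax - 1) * (2 * 10 * i2Q (m + 3) l) ≤ 2 * 10 ^ 2 * t)

/-- The corrected two-branch envelope for an origin-cell entry. [cite: FitznerVanDerHofstad2016NoBLE, §3.3.5 (3.61)–(3.62) p. 1076; (3.30) p. 1070] -/
def originEnvChk (α amax : ℚ) (m l : ℕ) (t : ℚ) : Bool :=
  decide (envQ (jOQ m l) (i0Q (m + 3) l) (2 * 10 * i2Q (m + 3) l) α amax ≤ t)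

/-- **Origin-cell entry check**: `m ≤ 1`, `l ≤ lO m`, then print's triple OR the envelope. [cite: FitznerVanDerHofstad2016NoBLE, §3.3.5 (3.61)–(3.64) p. 1076; (3.87) p. 1079 (cell `{0}`)] -/
def originChk (α amax : ℚ) (m l : ℕ) (t : ℚ) : Bool :=
  decide (m ≤ 1) && decide (l ≤ lO m) && (originPrintChk α amax m l t || originEnvChk α amax m l t)

/-- Soundness of `originChk`: `OriginDomAlt 10 α ᾱ m l t`. [cite: FitznerVanDerHofstad2016NoBLE, §3.3.5 (3.61)–(3.64) p. 1076; (3.87) p. 1079 (cell `{0}`)] -/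
theorem originDomAlt_of_chk (hα : 0 < α) (hᾱ : 1 ≤ amax) (h : originChk α amax m l t = true) :
    OriginDomAlt 10 (α : ℝ) (amax : ℝ) m l (t : ℝ) := by
  simp only [originChk, originPrintChk, originEnvChk, Bool.and_eq_true, Bool.or_eq_true, decide_eq_true_eq] at h
  obtain ⟨⟨hm, hl⟩, ⟨⟨h1, h2⟩, h3⟩ | he⟩ := h
  · exact originDomAlt_d10_of_printedQ hᾱ hm hl h1 h2 h3
  · exact originDomAlt_d10_of_envQ hα hᾱ hm hl he

end Entry

/-! ### §3  Per-slot closing theorems with decidable hypotheses only -/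

section Slot

variable {α amax bq : ℚ} {aq : ArgsQ} {IMq : ℤ → ℕ → ℚ} {l : ℕ}

/-- **`𝒳`-cell `(0,l)` at `d := 10`, rule `T` slot, all hypotheses decidable**: `CellSupD10.f3cellD10_zero_calX_le` with `a.WF`
from `aq.wfCheck`, the two `IM` entries from `cellChk`, the `m = −1` pair from `negOne{Fst,Snd}Chk`, and `hnum` from `boundHD75Q`.
[cite: FitznerVanDerHofstad2016NoBLE, §3.3.5 (3.87) p. 1079; (3.58)–(3.64) p. 1076] [cite: FitznerVanDerHofstad2017, §2.5] -/
theorem slotX_zero_le (hα : 1 ≤ α) (hᾱ : 1 ≤ amax) (hwf : aq.wfCheck = true) (hl : l ≤ 20)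
    (hE0 : cellChk α amax 0 l (IMq 0 l) = true) (hE0' : cellChk α amax 0 (l + 1) (IMq 0 (l + 1)) = true)
    (hN1 : negOneFstChk α l (IMq (-1) l) = true) (hN2 : negOneSndChk α l (IMq (-1) l) = true)
    (hnum : boundHD75Q IMq tS2 uS2 kS2 0 l aq ≤ bq) :
    ∀ x ∈ calX 10, boundHD75 (srwTrueAlt 10 (α : ℝ) (amax : ℝ)) 0 l x aq.toArgs ≤ ((bq : ℚ) : ℝ) :=
  have hα0 : 0 < α := by linarith
  f3cellD10_zero_calX_le (by exact_mod_cast hα) (by exact_mod_cast hᾱ) (ArgsQ.toArgs_WF hwf)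
    (IMc := fun m l => ((IMq m l : ℚ) : ℝ)) hl
    (cellDomAlt_of_chk hα0 hᾱ hE0) (cellDomAlt_of_chk hα0 hᾱ hE0') (negOne_fst_of_chk hα0 hN1) (negOne_snd_of_chk hN2)
    (boundHD75_cell_le_of_ratLe IMq tS2 uS2 kS2 0 hnum)

/-- **`𝒳`-cells `(1,l)` at `d := 10`, rule `T` slot, all hypotheses decidable**: `CellSupD10.f3cellD10_one_calX_le` likewise.
[cite: FitznerVanDerHofstad2016NoBLE, §3.3.5 (3.87) p. 1079; (3.58)–(3.64) p. 1076] [cite: FitznerVanDerHofstad2017, §2.5] -/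
theorem slotX_one_le (hα : 1 ≤ α) (hᾱ : 1 ≤ amax) (hwf : aq.wfCheck = true) (hl : l ≤ 20)
    (hE1 : cellChk α amax 1 l (IMq 1 l) = true) (hE0 : cellChk α amax 0 l (IMq 0 l) = true)
    (hE1' : cellChk α amax 1 (l + 1) (IMq 1 (l + 1)) = true) (hE0' : cellChk α amax 0 (l + 1) (IMq 0 (l + 1)) = true)
    (hE1'' : cellChk α amax 1 (l + 2) (IMq 1 (l + 2)) = true)
    (hnum : boundHD75Q IMq tS2 uS2 kS2 1 l aq ≤ bq) :
    ∀ x ∈ calX 10, boundHD75 (srwTrueAlt 10 (α : ℝ) (amax : ℝ)) 1 l x aq.toArgs ≤ ((bq : ℚ) : ℝ) :=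
  have hα0 : 0 < α := by linarith
  f3cellD10_one_calX_le (by exact_mod_cast hα) (by exact_mod_cast hᾱ) (ArgsQ.toArgs_WF hwf)
    (IMc := fun m l => ((IMq m l : ℚ) : ℝ)) hl
    (cellDomAlt_of_chk hα0 hᾱ hE1) (cellDomAlt_of_chk hα0 hᾱ hE0) (cellDomAlt_of_chk hα0 hᾱ hE1')
    (cellDomAlt_of_chk hα0 hᾱ hE0') (cellDomAlt_of_chk hα0 hᾱ hE1'')
    (boundHD75_cell_le_of_ratLe IMq tS2 uS2 kS2 0 hnum)

/-- **`𝒳`-cell `(0,l)` at `d := 10`, DIRECT `T` slot `tXD α`, all hypotheses decidable**: `CellSupD10.f3cellD10D_zero_calX_le`.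
[cite: FitznerVanDerHofstad2016NoBLE, §3.3.5 (3.87) p. 1079; (3.58)–(3.64) p. 1076; §5.2 (5.9), (5.15) p. 1092] [cite: FitznerVanDerHofstad2017, §2.5] -/
theorem slotXD_zero_le (hα : 1 ≤ α) (hᾱ : 1 ≤ amax) (hwf : aq.wfCheck = true) (hl : l ≤ 20)
    (hE0 : cellChk α amax 0 l (IMq 0 l) = true) (hE0' : cellChk α amax 0 (l + 1) (IMq 0 (l + 1)) = true)
    (hN1 : negOneFstChk α l (IMq (-1) l) = true) (hN2 : negOneSndChk α l (IMq (-1) l) = true)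
    (hnum : boundHD75Q IMq (tXDQ α) uS2 kS2 0 l aq ≤ bq) :
    ∀ x ∈ calX 10, boundHD75 (srwTrueAlt 10 (α : ℝ) (amax : ℝ)) 0 l x aq.toArgs ≤ ((bq : ℚ) : ℝ) :=
  have hα0 : 0 < α := by linarith
  f3cellD10D_zero_calX_le (by exact_mod_cast hα) (by exact_mod_cast hᾱ) (ArgsQ.toArgs_WF hwf)
    (IMc := fun m l => ((IMq m l : ℚ) : ℝ)) hl
    (cellDomAlt_of_chk hα0 hᾱ hE0) (cellDomAlt_of_chk hα0 hᾱ hE0') (negOne_fst_of_chk hα0 hN1) (negOne_snd_of_chk hN2)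
    (boundHD75_cellXD_le_of_ratLe IMq hnum)

/-- **`𝒳`-cells `(1,l)` at `d := 10`, DIRECT `T` slot `tXD α`, all hypotheses decidable**: `CellSupD10.f3cellD10D_one_calX_le`.
[cite: FitznerVanDerHofstad2016NoBLE, §3.3.5 (3.87) p. 1079; (3.58)–(3.64) p. 1076; §5.2 (5.9), (5.15) p. 1092] [cite: FitznerVanDerHofstad2017, §2.5] -/
theorem slotXD_one_le (hα : 1 ≤ α) (hᾱ : 1 ≤ amax) (hwf : aq.wfCheck = true) (hl : l ≤ 20)
    (hE1 : cellChk α amax 1 l (IMq 1 l) = true) (hE0 : cellChk α amax 0 l (IMq 0 l) = true)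
    (hE1' : cellChk α amax 1 (l + 1) (IMq 1 (l + 1)) = true) (hE0' : cellChk α amax 0 (l + 1) (IMq 0 (l + 1)) = true)
    (hE1'' : cellChk α amax 1 (l + 2) (IMq 1 (l + 2)) = true)
    (hnum : boundHD75Q IMq (tXDQ α) uS2 kS2 1 l aq ≤ bq) :
    ∀ x ∈ calX 10, boundHD75 (srwTrueAlt 10 (α : ℝ) (amax : ℝ)) 1 l x aq.toArgs ≤ ((bq : ℚ) : ℝ) :=
  have hα0 : 0 < α := by linarith
  f3cellD10D_one_calX_le (by exact_mod_cast hα) (by exact_mod_cast hᾱ) (ArgsQ.toArgs_WF hwf)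
    (IMc := fun m l => ((IMq m l : ℚ) : ℝ)) hl
    (cellDomAlt_of_chk hα0 hᾱ hE1) (cellDomAlt_of_chk hα0 hᾱ hE0) (cellDomAlt_of_chk hα0 hᾱ hE1')
    (cellDomAlt_of_chk hα0 hᾱ hE0') (cellDomAlt_of_chk hα0 hᾱ hE1'')
    (boundHD75_cellXD_le_of_ratLe IMq hnum)

/-- **Cone cell `(0,l)` on `Cn.cone v` at `d := 10`, rule `T` slot, all hypotheses decidable**: `CellSupD10.f3cellD10_zero_on_le`
at `C := Cn.cone v` (`Cn.cone_subset_Q10 v`) with the entries from `coneChk v` and the pair from `coneNegOne{Fst,Snd}Chk v`.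
[cite: FitznerVanDerHofstad2016NoBLE, §3.3.5 (3.87) p. 1079; §5.1 p. 1093; (3.58)–(3.64) p. 1076] [cite: FitznerVanDerHofstad2017, §2.5] -/
theorem slotCone_zero_le (v : Cn) (hα : 1 ≤ α) (hᾱ : 1 ≤ amax) (hwf : aq.wfCheck = true) (hl : l ≤ 20)
    (hE0 : coneChk v α amax 0 l (IMq 0 l) = true) (hE0' : coneChk v α amax 0 (l + 1) (IMq 0 (l + 1)) = true)
    (hN1 : coneNegOneFstChk v α l (IMq (-1) l) = true) (hN2 : coneNegOneSndChk v α l (IMq (-1) l) = true)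
    (hnum : boundHD75Q IMq tS3 uS3 kS3 0 l aq ≤ bq) :
    ∀ x ∈ v.cone, boundHD75 (srwTrueAlt 10 (α : ℝ) (amax : ℝ)) 0 l x aq.toArgs ≤ ((bq : ℚ) : ℝ) :=
  have hα0 : 0 < α := by linarith
  f3cellD10_zero_on_le (Cn.cone_subset_Q10 v) (by exact_mod_cast hα) (by exact_mod_cast hᾱ) (ArgsQ.toArgs_WF hwf)
    (IMc := fun m l => ((IMq m l : ℚ) : ℝ)) hl
    (onDomAlt_of_chk v hᾱ hE0) (onDomAlt_of_chk v hᾱ hE0') (coneNegOne_fst_of_chk v hα0 hN1) (coneNegOne_snd_of_chk v hN2)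
    (boundHD75_cell_le_of_ratLe IMq tS3 uS3 kS3 0 hnum)

/-- **Cone cells `(1,l)` on `Cn.cone v` at `d := 10`, rule `T` slot, all hypotheses decidable**: `CellSupD10.f3cellD10_one_on_le` at
`C := Cn.cone v`. [cite: FitznerVanDerHofstad2016NoBLE, §3.3.5 (3.87) p. 1079; §5.1 p. 1093; (3.58)–(3.64) p. 1076] [cite: FitznerVanDerHofstad2017, §2.5] -/
theorem slotCone_one_le (v : Cn) (hα : 1 ≤ α) (hᾱ : 1 ≤ amax) (hwf : aq.wfCheck = true) (hl : l ≤ 20)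
    (hE1 : coneChk v α amax 1 l (IMq 1 l) = true) (hE0 : coneChk v α amax 0 l (IMq 0 l) = true)
    (hE1' : coneChk v α amax 1 (l + 1) (IMq 1 (l + 1)) = true) (hE0' : coneChk v α amax 0 (l + 1) (IMq 0 (l + 1)) = true)
    (hE1'' : coneChk v α amax 1 (l + 2) (IMq 1 (l + 2)) = true)
    (hnum : boundHD75Q IMq tS3 uS3 kS3 1 l aq ≤ bq) :
    ∀ x ∈ v.cone, boundHD75 (srwTrueAlt 10 (α : ℝ) (amax : ℝ)) 1 l x aq.toArgs ≤ ((bq : ℚ) : ℝ) :=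
  f3cellD10_one_on_le (Cn.cone_subset_Q10 v) (by exact_mod_cast hα) (by exact_mod_cast hᾱ) (ArgsQ.toArgs_WF hwf)
    (IMc := fun m l => ((IMq m l : ℚ) : ℝ)) hl
    (onDomAlt_of_chk v hᾱ hE1) (onDomAlt_of_chk v hᾱ hE0) (onDomAlt_of_chk v hᾱ hE1') (onDomAlt_of_chk v hᾱ hE0')
    (onDomAlt_of_chk v hᾱ hE1'')
    (boundHD75_cell_le_of_ratLe IMq tS3 uS3 kS3 0 hnum)

/-- **Cone cell `(0,l)` on `Cn.cone v` at `d := 10`, DIRECT `T` slot `tQD α`, all hypotheses decidable**: `CellSupD10.f3cellD10D_zero_on_le`.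
[cite: FitznerVanDerHofstad2016NoBLE, §3.3.5 (3.87) p. 1079; §5.1 p. 1093; (3.58)–(3.64) p. 1076; §5.2 (5.9), (5.15) p. 1092] [cite: FitznerVanDerHofstad2017, §2.5] -/
theorem slotConeD_zero_le (v : Cn) (hα : 1 ≤ α) (hᾱ : 1 ≤ amax) (hwf : aq.wfCheck = true) (hl : l ≤ 20)
    (hE0 : coneChk v α amax 0 l (IMq 0 l) = true) (hE0' : coneChk v α amax 0 (l + 1) (IMq 0 (l + 1)) = true)
    (hN1 : coneNegOneFstChk v α l (IMq (-1) l) = true) (hN2 : coneNegOneSndChk v α l (IMq (-1) l) = true)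
    (hnum : boundHD75Q IMq (tQDQ α) uS3 kS3 0 l aq ≤ bq) :
    ∀ x ∈ v.cone, boundHD75 (srwTrueAlt 10 (α : ℝ) (amax : ℝ)) 0 l x aq.toArgs ≤ ((bq : ℚ) : ℝ) :=
  have hα0 : 0 < α := by linarith
  f3cellD10D_zero_on_le (Cn.cone_subset_Q10 v) (by exact_mod_cast hα) (by exact_mod_cast hᾱ) (ArgsQ.toArgs_WF hwf)
    (IMc := fun m l => ((IMq m l : ℚ) : ℝ)) hl
    (onDomAlt_of_chk v hᾱ hE0) (onDomAlt_of_chk v hᾱ hE0') (coneNegOne_fst_of_chk v hα0 hN1) (coneNegOne_snd_of_chk v hN2)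
    (boundHD75_cellQD_le_of_ratLe IMq hnum)

/-- **Cone cells `(1,l)` on `Cn.cone v` at `d := 10`, DIRECT `T` slot `tQD α`, all hypotheses decidable**: `CellSupD10.f3cellD10D_one_on_le`.
[cite: FitznerVanDerHofstad2016NoBLE, §3.3.5 (3.87) p. 1079; §5.1 p. 1093; (3.58)–(3.64) p. 1076; §5.2 (5.9), (5.15) p. 1092] [cite: FitznerVanDerHofstad2017, §2.5] -/
theorem slotConeD_one_le (v : Cn) (hα : 1 ≤ α) (hᾱ : 1 ≤ amax) (hwf : aq.wfCheck = true) (hl : l ≤ 20)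
    (hE1 : coneChk v α amax 1 l (IMq 1 l) = true) (hE0 : coneChk v α amax 0 l (IMq 0 l) = true)
    (hE1' : coneChk v α amax 1 (l + 1) (IMq 1 (l + 1)) = true) (hE0' : coneChk v α amax 0 (l + 1) (IMq 0 (l + 1)) = true)
    (hE1'' : coneChk v α amax 1 (l + 2) (IMq 1 (l + 2)) = true)
    (hnum : boundHD75Q IMq (tQDQ α) uS3 kS3 1 l aq ≤ bq) :
    ∀ x ∈ v.cone, boundHD75 (srwTrueAlt 10 (α : ℝ) (amax : ℝ)) 1 l x aq.toArgs ≤ ((bq : ℚ) : ℝ) :=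
  f3cellD10D_one_on_le (Cn.cone_subset_Q10 v) (by exact_mod_cast hα) (by exact_mod_cast hᾱ) (ArgsQ.toArgs_WF hwf)
    (IMc := fun m l => ((IMq m l : ℚ) : ℝ)) hl
    (onDomAlt_of_chk v hᾱ hE1) (onDomAlt_of_chk v hᾱ hE0) (onDomAlt_of_chk v hᾱ hE1') (onDomAlt_of_chk v hᾱ hE0')
    (onDomAlt_of_chk v hᾱ hE1'')
    (boundHD75_cellQD_le_of_ratLe IMq hnum)

/-- **Origin cell `(1,l)` at `d := 10`, rule `T` slot at the node `n0`, all hypotheses decidable**: `CellSupD10.f3cellD10_one_zero_le`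
with the five `IM` entries from `originChk` and `hnum` from `boundHD75Q` at the tables `tA/uA/kA · · .n0`.
[cite: FitznerVanDerHofstad2016NoBLE, §3.3.5 (3.87) p. 1079 (cell `{0}`); (3.30), (3.35) p. 1070; (3.58)–(3.64) p. 1076] [cite: FitznerVanDerHofstad2017, §2.5] -/
theorem slotOrigin_one_le (hα : 1 ≤ α) (hᾱ : 1 ≤ amax) (hwf : aq.wfCheck = true) (hl : l ≤ 17)
    (hE1 : originChk α amax 1 l (IMq 1 l) = true) (hE0 : originChk α amax 0 l (IMq 0 l) = true)
    (hE1' : originChk α amax 1 (l + 1) (IMq 1 (l + 1)) = true) (hE0' : originChk α amax 0 (l + 1) (IMq 0 (l + 1)) = true)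
    (hE1'' : originChk α amax 1 (l + 2) (IMq 1 (l + 2)) = true)
    (hnum : boundHD75Q IMq (fun m l => tA m l .n0) (fun n l => uA n l .n0) (fun n l => kA n l .n0) 1 l aq ≤ bq) :
    boundHD75 (srwTrueAlt 10 (α : ℝ) (amax : ℝ)) 1 l 0 aq.toArgs ≤ ((bq : ℚ) : ℝ) :=
  have hα0 : 0 < α := by linarith
  f3cellD10_one_zero_le (afmax := (amax : ℝ)) (by exact_mod_cast hα) (ArgsQ.toArgs_WF hwf)
    (IMc := fun m l => ((IMq m l : ℚ) : ℝ)) hl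
    (originDomAlt_of_chk hα0 hᾱ hE1) (originDomAlt_of_chk hα0 hᾱ hE0) (originDomAlt_of_chk hα0 hᾱ hE1')
    (originDomAlt_of_chk hα0 hᾱ hE0') (originDomAlt_of_chk hα0 hᾱ hE1'')
    (boundHD75_cellN_le_of_ratLe IMq .n0 hnum)

/-- **Origin cell `(1,l)` at `d := 10`, DIRECT `T` slot `tND α n0`, all hypotheses decidable** (`l ≤ 16`): `CellSupD10.f3cellD10D_one_zero_le`.
[cite: FitznerVanDerHofstad2016NoBLE, §3.3.5 (3.87) p. 1079 (cell `{0}`); (3.30), (3.35) p. 1070; §5.2 (5.9), (5.15) p. 1092] [cite: FitznerVanDerHofstad2017, §2.5] -/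
theorem slotOriginD_one_le (hα : 1 ≤ α) (hᾱ : 1 ≤ amax) (hwf : aq.wfCheck = true) (hl : l ≤ 16)
    (hE1 : originChk α amax 1 l (IMq 1 l) = true) (hE0 : originChk α amax 0 l (IMq 0 l) = true)
    (hE1' : originChk α amax 1 (l + 1) (IMq 1 (l + 1)) = true) (hE0' : originChk α amax 0 (l + 1) (IMq 0 (l + 1)) = true)
    (hE1'' : originChk α amax 1 (l + 2) (IMq 1 (l + 2)) = true)
    (hnum : boundHD75Q IMq (tNDQ α .n0) (fun n l => uA n l .n0) (fun n l => kA n l .n0) 1 l aq ≤ bq) :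
    boundHD75 (srwTrueAlt 10 (α : ℝ) (amax : ℝ)) 1 l 0 aq.toArgs ≤ ((bq : ℚ) : ℝ) :=
  have hα0 : 0 < α := by linarith
  f3cellD10D_one_zero_le (afmax := (amax : ℝ)) (by exact_mod_cast hα) (ArgsQ.toArgs_WF hwf)
    (IMc := fun m l => ((IMq m l : ℚ) : ℝ)) hl
    (originDomAlt_of_chk hα0 hᾱ hE1) (originDomAlt_of_chk hα0 hᾱ hE0) (originDomAlt_of_chk hα0 hᾱ hE1')
    (originDomAlt_of_chk hα0 hᾱ hE0') (originDomAlt_of_chk hα0 hᾱ hE1'')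
    (boundHD75_cellND_le_of_ratLe IMq .n0 hnum)

end Slot

/-! ### §4  The glued `Q`-shape `∀ x, 3 ≤ Σ_j |x_j| → …` from the three cone slots -/

section QSlot

variable {α amax bq : ℚ} {aq : ArgsQ} {IM3 IM21 IM111 : ℤ → ℕ → ℚ} {l : ℕ}

/-- **Cell `(0,l)` on all of `Q` in the shape of the small-`x` hypothesis `h0Q`** (`∀ x, 3 ≤ Σ_j |x_j| → …`), rule `T` slot, all
hypotheses decidable: the three cone slots `slotCone_zero_le v` (one `IM` table per cone) glued by `CellImD10.boundHD75_Q_le_of_cones`.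
[cite: FitznerVanDerHofstad2016NoBLE, §3.3.5 (3.87) p. 1079; §5.1 p. 1093] [cite: FitznerVanDerHofstad2017, §2.5] -/
theorem slotQ_zero_le (hα : 1 ≤ α) (hᾱ : 1 ≤ amax) (hwf : aq.wfCheck = true) (hl : l ≤ 20)
    (h3E0 : coneChk .v3 α amax 0 l (IM3 0 l) = true) (h3E0' : coneChk .v3 α amax 0 (l + 1) (IM3 0 (l + 1)) = true)
    (h3N1 : coneNegOneFstChk .v3 α l (IM3 (-1) l) = true) (h3N2 : coneNegOneSndChk .v3 α l (IM3 (-1) l) = true)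
    (h3num : boundHD75Q IM3 tS3 uS3 kS3 0 l aq ≤ bq)
    (h21E0 : coneChk .v21 α amax 0 l (IM21 0 l) = true) (h21E0' : coneChk .v21 α amax 0 (l + 1) (IM21 0 (l + 1)) = true)
    (h21N1 : coneNegOneFstChk .v21 α l (IM21 (-1) l) = true) (h21N2 : coneNegOneSndChk .v21 α l (IM21 (-1) l) = true)
    (h21num : boundHD75Q IM21 tS3 uS3 kS3 0 l aq ≤ bq)
    (h111E0 : coneChk .v111 α amax 0 l (IM111 0 l) = true) (h111E0' : coneChk .v111 α amax 0 (l + 1) (IM111 0 (l + 1)) = true)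
    (h111N1 : coneNegOneFstChk .v111 α l (IM111 (-1) l) = true) (h111N2 : coneNegOneSndChk .v111 α l (IM111 (-1) l) = true)
    (h111num : boundHD75Q IM111 tS3 uS3 kS3 0 l aq ≤ bq) :
    ∀ x : Fin 10 → ℤ, 3 ≤ ∑ j, |x j| → boundHD75 (srwTrueAlt 10 (α : ℝ) (amax : ℝ)) 0 l x aq.toArgs ≤ ((bq : ℚ) : ℝ) :=
  boundHD75_Q_le_of_cones
    (slotCone_zero_le .v3 hα hᾱ hwf hl h3E0 h3E0' h3N1 h3N2 h3num)
    (slotCone_zero_le .v21 hα hᾱ hwf hl h21E0 h21E0' h21N1 h21N2 h21num)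
    (slotCone_zero_le .v111 hα hᾱ hwf hl h111E0 h111E0' h111N1 h111N2 h111num)

/-- **Cell `(1,l)` on all of `Q` in the shape of `h1Q`**, rule `T` slot, all hypotheses decidable: the three `slotCone_one_le v` glued by
`CellImD10.boundHD75_Q_le_of_cones`. [cite: FitznerVanDerHofstad2016NoBLE, §3.3.5 (3.87) p. 1079; §5.1 p. 1093] [cite: FitznerVanDerHofstad2017, §2.5] -/
theorem slotQ_one_le (hα : 1 ≤ α) (hᾱ : 1 ≤ amax) (hwf : aq.wfCheck = true) (hl : l ≤ 20)
    (h3E1 : coneChk .v3 α amax 1 l (IM3 1 l) = true) (h3E0 : coneChk .v3 α amax 0 l (IM3 0 l) = true)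
    (h3E1' : coneChk .v3 α amax 1 (l + 1) (IM3 1 (l + 1)) = true) (h3E0' : coneChk .v3 α amax 0 (l + 1) (IM3 0 (l + 1)) = true)
    (h3E1'' : coneChk .v3 α amax 1 (l + 2) (IM3 1 (l + 2)) = true)
    (h3num : boundHD75Q IM3 tS3 uS3 kS3 1 l aq ≤ bq)
    (h21E1 : coneChk .v21 α amax 1 l (IM21 1 l) = true) (h21E0 : coneChk .v21 α amax 0 l (IM21 0 l) = true)
    (h21E1' : coneChk .v21 α amax 1 (l + 1) (IM21 1 (l + 1)) = true) (h21E0' : coneChk .v21 α amax 0 (l + 1) (IM21 0 (l + 1)) = true)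
    (h21E1'' : coneChk .v21 α amax 1 (l + 2) (IM21 1 (l + 2)) = true)
    (h21num : boundHD75Q IM21 tS3 uS3 kS3 1 l aq ≤ bq)
    (h111E1 : coneChk .v111 α amax 1 l (IM111 1 l) = true) (h111E0 : coneChk .v111 α amax 0 l (IM111 0 l) = true)
    (h111E1' : coneChk .v111 α amax 1 (l + 1) (IM111 1 (l + 1)) = true)
    (h111E0' : coneChk .v111 α amax 0 (l + 1) (IM111 0 (l + 1)) = true)
    (h111E1'' : coneChk .v111 α amax 1 (l + 2) (IM111 1 (l + 2)) = true)
    (h111num : boundHD75Q IM111 tS3 uS3 kS3 1 l aq ≤ bq) :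
    ∀ x : Fin 10 → ℤ, 3 ≤ ∑ j, |x j| → boundHD75 (srwTrueAlt 10 (α : ℝ) (amax : ℝ)) 1 l x aq.toArgs ≤ ((bq : ℚ) : ℝ) :=
  boundHD75_Q_le_of_cones
    (slotCone_one_le .v3 hα hᾱ hwf hl h3E1 h3E0 h3E1' h3E0' h3E1'' h3num)
    (slotCone_one_le .v21 hα hᾱ hwf hl h21E1 h21E0 h21E1' h21E0' h21E1'' h21num)
    (slotCone_one_le .v111 hα hᾱ hwf hl h111E1 h111E0 h111E1' h111E0' h111E1'' h111num)

/-- **Cell `(0,l)` on all of `Q`, DIRECT `T` slot `tQD α`**, all hypotheses decidable: the three `slotConeD_zero_le v` glued.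
[cite: FitznerVanDerHofstad2016NoBLE, §3.3.5 (3.87) p. 1079; §5.1 p. 1093; §5.2 (5.9), (5.15) p. 1092] [cite: FitznerVanDerHofstad2017, §2.5] -/
theorem slotQD_zero_le (hα : 1 ≤ α) (hᾱ : 1 ≤ amax) (hwf : aq.wfCheck = true) (hl : l ≤ 20)
    (h3E0 : coneChk .v3 α amax 0 l (IM3 0 l) = true) (h3E0' : coneChk .v3 α amax 0 (l + 1) (IM3 0 (l + 1)) = true)
    (h3N1 : coneNegOneFstChk .v3 α l (IM3 (-1) l) = true) (h3N2 : coneNegOneSndChk .v3 α l (IM3 (-1) l) = true)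
    (h3num : boundHD75Q IM3 (tQDQ α) uS3 kS3 0 l aq ≤ bq)
    (h21E0 : coneChk .v21 α amax 0 l (IM21 0 l) = true) (h21E0' : coneChk .v21 α amax 0 (l + 1) (IM21 0 (l + 1)) = true)
    (h21N1 : coneNegOneFstChk .v21 α l (IM21 (-1) l) = true) (h21N2 : coneNegOneSndChk .v21 α l (IM21 (-1) l) = true)
    (h21num : boundHD75Q IM21 (tQDQ α) uS3 kS3 0 l aq ≤ bq)
    (h111E0 : coneChk .v111 α amax 0 l (IM111 0 l) = true) (h111E0' : coneChk .v111 α amax 0 (l + 1) (IM111 0 (l + 1)) = true)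
    (h111N1 : coneNegOneFstChk .v111 α l (IM111 (-1) l) = true) (h111N2 : coneNegOneSndChk .v111 α l (IM111 (-1) l) = true)
    (h111num : boundHD75Q IM111 (tQDQ α) uS3 kS3 0 l aq ≤ bq) :
    ∀ x : Fin 10 → ℤ, 3 ≤ ∑ j, |x j| → boundHD75 (srwTrueAlt 10 (α : ℝ) (amax : ℝ)) 0 l x aq.toArgs ≤ ((bq : ℚ) : ℝ) :=
  boundHD75_Q_le_of_cones
    (slotConeD_zero_le .v3 hα hᾱ hwf hl h3E0 h3E0' h3N1 h3N2 h3num)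
    (slotConeD_zero_le .v21 hα hᾱ hwf hl h21E0 h21E0' h21N1 h21N2 h21num)
    (slotConeD_zero_le .v111 hα hᾱ hwf hl h111E0 h111E0' h111N1 h111N2 h111num)

/-- **Cell `(1,l)` on all of `Q`, DIRECT `T` slot `tQD α`**, all hypotheses decidable: the three `slotConeD_one_le v` glued.
[cite: FitznerVanDerHofstad2016NoBLE, §3.3.5 (3.87) p. 1079; §5.1 p. 1093; §5.2 (5.9), (5.15) p. 1092] [cite: FitznerVanDerHofstad2017, §2.5] -/
theorem slotQD_one_le (hα : 1 ≤ α) (hᾱ : 1 ≤ amax) (hwf : aq.wfCheck = true) (hl : l ≤ 20)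
    (h3E1 : coneChk .v3 α amax 1 l (IM3 1 l) = true) (h3E0 : coneChk .v3 α amax 0 l (IM3 0 l) = true)
    (h3E1' : coneChk .v3 α amax 1 (l + 1) (IM3 1 (l + 1)) = true) (h3E0' : coneChk .v3 α amax 0 (l + 1) (IM3 0 (l + 1)) = true)
    (h3E1'' : coneChk .v3 α amax 1 (l + 2) (IM3 1 (l + 2)) = true)
    (h3num : boundHD75Q IM3 (tQDQ α) uS3 kS3 1 l aq ≤ bq)
    (h21E1 : coneChk .v21 α amax 1 l (IM21 1 l) = true) (h21E0 : coneChk .v21 α amax 0 l (IM21 0 l) = true)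
    (h21E1' : coneChk .v21 α amax 1 (l + 1) (IM21 1 (l + 1)) = true) (h21E0' : coneChk .v21 α amax 0 (l + 1) (IM21 0 (l + 1)) = true)
    (h21E1'' : coneChk .v21 α amax 1 (l + 2) (IM21 1 (l + 2)) = true)
    (h21num : boundHD75Q IM21 (tQDQ α) uS3 kS3 1 l aq ≤ bq)
    (h111E1 : coneChk .v111 α amax 1 l (IM111 1 l) = true) (h111E0 : coneChk .v111 α amax 0 l (IM111 0 l) = true)
    (h111E1' : coneChk .v111 α amax 1 (l + 1) (IM111 1 (l + 1)) = true)
    (h111E0' : coneChk .v111 α amax 0 (l + 1) (IM111 0 (l + 1)) = true)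
    (h111E1'' : coneChk .v111 α amax 1 (l + 2) (IM111 1 (l + 2)) = true)
    (h111num : boundHD75Q IM111 (tQDQ α) uS3 kS3 1 l aq ≤ bq) :
    ∀ x : Fin 10 → ℤ, 3 ≤ ∑ j, |x j| → boundHD75 (srwTrueAlt 10 (α : ℝ) (amax : ℝ)) 1 l x aq.toArgs ≤ ((bq : ℚ) : ℝ) :=
  boundHD75_Q_le_of_cones
    (slotConeD_one_le .v3 hα hᾱ hwf hl h3E1 h3E0 h3E1' h3E0' h3E1'' h3num)
    (slotConeD_one_le .v21 hα hᾱ hwf hl h21E1 h21E0 h21E1' h21E0' h21E1'' h21num)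
    (slotConeD_one_le .v111 hα hᾱ hwf hl h111E1 h111E0 h111E1' h111E0' h111E1'' h111num)

end QSlot

end SlotD10

end Literature.Probability.FitznerVanDerHofstad2017
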